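import Summits.NavierStokesRegularity.FunctionalMining.TopEigSecondDiffSimple
import Summits.NavierStokesRegularity.FunctionalMining.TopEigAmplitudeFloorHolds
import HarnessLib

/-!
# FunctionalMining — THE CHANNEL FLOOR OF THE `Φ_q` HEAT PRICE FOR EVERY SMOOTH FIELD:
# `q(q−1)∫λ₁^{q−2}|∇λ₁|² + 2q∫_{U_s} λ₁^{q−1} R ≤ T_q(v)` — no gap class, no simplicity hypothesis

HONEST FRAMING. Search for candidate a priori estimates; no regularity claim. Cell `pub-nsfunc`, prove
seat (gen 32). Nothing about Navier–Stokes solutions is asserted; the subject is the STATIC heat price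
`T_q(v) = heatDissipation Φ_q v` of `Φ_q = ∫(λ₁⁺)^q` at ONE smooth divergence-free field `v` on `T³`.

WHAT THE TREE HAD. (i) LEMMA AF (`topEigAmplitudeFloor_of_two_le`, census-2 / prove g25): for every real
`q ≥ 2` and EVERY smooth divergence-free `v`, `q(q−1)∫λ₁^{q−2}Σₖ(∂ₖλ₁)² ≤ T_q(v)` — the grad-λ channel only,
by SECOND DIFFERENCE QUOTIENTS (pointwise `Σₖ[λ(x+teₖ)+λ(x−teₖ)−2λ(x)] ≥ t²μ(x) − C|t|³` from "`λ₁ ≥ eᵀS(·)e`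
with equality at `x`", discrete integration by parts, Rademacher, `t → 0⁺`). (ii) N14b / Cor. 3′(a)
(`TopEigColumnCharge`, `TopEigChannelIntegralSimple`): the FULL density `q(q−1)λ₁^{q−2}A + 2qλ₁^{q−1}R`
(`A = Σₖ(u₀ᵀSₖu₀)²`, `R = Σₖ Σ_{b≠a₀}(u_bᵀSₖu₀)²/(λ₁−κ_b) ≥ 0` the transverse channels of the R-form
`Δλ₁ = μ + 2R`) — but ONLY for fields whose top eigenvalue is simple EVERYWHERE, or (cut-off versions,
`TopEigGapCutoff*`) on the top-gap class.

WHAT IS PROVED HERE (every real `q ≥ 2`, EVERY smooth divergence-free `v`, no class):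
**`heatDissipation_ge_channelFloor`**: with `U_s = {λ₂ < λ₁}` the (open) simple set and `R = topChannelW`,
`q(q−1)∫λ₁^{q−2}Σₖ(∂ₖλ₁)² + 2∫ 1_{U_s}·qλ₁^{q−1}R ≤ T_q(v)`, and the channel term `1_{U_s}qλ₁^{q−1}R` is
INTEGRABLE (a consequence, not a hypothesis: the transverse-channel energy of every smooth field is paid
by its heat price). PROOF = LEMMA AF's argument with ONE refinement and Fatou: at a point of `U_s` the top
eigenvalue is `C^∞`, so the second difference quotient CONVERGES to `Σₖ∂ₖ∂ₖλ₁ = Δλ₁ = μ + 2R`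
(`tendsto_secondDiff_topEig_div_sq` of `TopEigSecondDiffSimple`, l'Hôpital on the coordinate line;
the tree's R-form `laplacian_torusStrainTopEig_eq_sum_frame`), while at every point AF's touching bound keeps the quotient
`≥ μ − Ct`; the integrals of `φ·(quotient)` (`φ = qλ₁^{q−1}`) converge to `−q(q−1)∫λ₁^{q−2}|∇λ₁|²` by the
tree's dominated slope limit (`tendsto_integral_slope_mul_slope`); Fatou (`lintegral_liminf_le'`) on the
non-negative functions `φ·(quotient − μ + Ct)` along `t = 1/(n+1)` gives the channel term.
CONSEQUENCE (recorded, not used here): the heat side of the (LL) cut-off calculus needs no gap class; the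
gap class enters Proposition L-λ(η) only through the smoothness of the multiplier `λ₁^{q−1}P₁` (prove
DERIVATIVES §56/§57). NOT CLAIMED: `q < 2`; anything on the one-sided node L-λ(q) (OPEN); regularity.

[ours; the method is census-2's LEMMA G / AF second-difference argument]
FILING (prove seat g33, SLOT OWN-C2, granted GATED on C1 by LEAD (58v) INBOX l.5760): = staged `pub-nsfunc-prove/staged/g32-own/TopEigChannelFloor.lean` 46b77da6b3aa67fd; this line is the only addition.
-/

noncomputable section

open Filter Topology Matrix Finset MeasureTheory Set
open scoped ContDiff ENNReal

namespace Summit.NavierStokesRegularity.FunctionalMining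

open Literature.Analysis Literature.Analysis.FunctionSpaces Literature.Analysis.FunctionSpaces.Torus
  SharpClass.DirectorForm Literature.Analysis.Matrix StrainL4

namespace TopEig

variable {v : UnitAddTorus (Fin 3) → EuclideanSpace ℝ (Fin 3)}

/-! ## The channel floor for every smooth field -/

/-- The Danskin density `μ(x) = μ(S(x); S(Δv)(x))` is Borel measurable (a pointwise limit of continuous
difference quotients). [ours, bookkeeping] -/
theorem measurable_dirTopEig_strain (hv : Torus.IsSmooth v) :
    Measurable fun x => dirTopEig (strainFlat v x) (strainFlat (Torus.laplacian v) x) := by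
  -- the quotients along `t = 1/(n+1)` are continuous and converge pointwise
  have hseq : Tendsto (fun n : ℕ => (1 : ℝ) / ((n : ℝ) + 1)) atTop (𝓝[>] 0) := by
    refine tendsto_nhdsWithin_of_tendsto_nhds_of_eventually_within _ tendsto_one_div_add_atTop_nhds_zero_nat ?_
    exact Eventually.of_forall fun n => Set.mem_Ioi.2 (by positivity)
  refine measurable_of_tendsto_metrizable (f := fun n x =>
    (lam (strainFlat v x + ((1 : ℝ) / ((n : ℝ) + 1)) • strainFlat (Torus.laplacian v) x) ^ (1 : ℝ) -
      lam (strainFlat v x + (0 : ℝ) • strainFlat (Torus.laplacian v) x) ^ (1 : ℝ)) /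
      ((1 : ℝ) / ((n : ℝ) + 1))) (fun n => ?_) ?_
  · exact (((continuous_lam_line_rpow hv hv.laplacian zero_le_one _).sub
      (continuous_lam_line_rpow hv hv.laplacian zero_le_one _)).div_const _).measurable
  · refine tendsto_pi_nhds.2 fun x => ?_
    have h := (tendsto_slope_lam_line_rpow (q := 1) le_rfl v (Torus.laplacian v) x).comp hseq
    have e : (1 : ℝ) * torusStrainTopEig v x ^ ((1 : ℝ) - 1) *
        dirTopEig (strainFlat v x) (strainFlat (Torus.laplacian v) x) =
        dirTopEig (strainFlat v x) (strainFlat (Torus.laplacian v) x) := by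
      rw [show (1 : ℝ) - 1 = 0 by norm_num, Real.rpow_zero]; ring
    rw [e] at h
    exact h

/-- **THE CHANNEL FLOOR (LEMMA AF WITH THE TRANSVERSE CHANNELS), every real `q ≥ 2`, every smooth
divergence-free `v` on `T³`.** With `U_s = {λ₂ < λ₁}` and `R = topChannelW v`:
the function `1_{U_s}·qλ₁^{q−1}R` is integrable and
`q(q−1)∫λ₁^{q−2}Σₖ(∂ₖλ₁)² + 2∫1_{U_s}·qλ₁^{q−1}R ≤ heatDissipation Φ_q v`.
No simplicity and no class hypothesis. [ours] -/
theorem heatDissipation_ge_channelFloor {q : ℝ} (hq : 2 ≤ q) (hv : Torus.IsSmooth v)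
    (hdv : Torus.IsDivFree v) :
    Integrable (Set.indicator {x | torusStrainMidEig v x < torusStrainTopEig v x}
      (fun x => q * torusStrainTopEig v x ^ (q - 1) * topChannelW v x)) volume ∧
    q * (q - 1) * (∫ x, torusStrainTopEig v x ^ (q - 2) *
        ∑ i, (Torus.partialDeriv i (fun y => torusStrainTopEig v y) x) ^ 2) +
      2 * ∫ x, Set.indicator {x | torusStrainMidEig v x < torusStrainTopEig v x}
        (fun x => q * torusStrainTopEig v x ^ (q - 1) * topChannelW v x) x ≤
      heatDissipation (torusTopEigMoment q) v := by
  have hq1 : (1 : ℝ) ≤ q := by linarith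
  set L := torusStrainTopEig v with hL
  set U : Set (UnitAddTorus (Fin 3)) := {x | torusStrainMidEig v x < torusStrainTopEig v x} with hUdef
  have hUo : IsOpen U := isOpen_setOf_midEig_lt_topEig hv
  set μ : UnitAddTorus (Fin 3) → ℝ := fun x => dirTopEig (strainFlat v x) (strainFlat (Torus.laplacian v) x)
    with hμdef
  set φ : UnitAddTorus (Fin 3) → ℝ := fun x => q * L x ^ (q - 1) with hφdef
  obtain ⟨C, hC⟩ := exists_topEig_secondDiff_ge hv
  have hLc : Continuous L := continuous_torusStrainTopEig hv
  have hLnn : ∀ y, 0 ≤ L y := fun y => by rw [hL, ← lam_strainFlat]; exact lam_strainFlat_nonneg hv hdv y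
  have hφc : Continuous φ := continuous_const.mul (hLc.rpow_const fun _ => Or.inr (by linarith))
  have hφnn : ∀ x, 0 ≤ φ x := fun x => mul_nonneg (by linarith) (Real.rpow_nonneg (hLnn x) _)
  have hφi : Integrable φ volume := hφc.integrable_unitAddTorus
  have hμm : Measurable μ := measurable_dirTopEig_strain hv
  have hint : Integrable (fun x => φ x * μ x) volume := integrable_danskinDensity hq1 hv hv.laplacian hdv
  -- the second differences
  set SD : ℝ → UnitAddTorus (Fin 3) → ℝ := fun t x =>
    ∑ i, (L (x + proj (t • EuclideanSpace.single i (1 : ℝ))) +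
      L (x + proj ((-t) • EuclideanSpace.single i (1 : ℝ))) - 2 * L x) with hSDdef
  have hSDc : ∀ t, Continuous (SD t) := fun t =>
    continuous_finsetSum _ fun i _ => ((hLc.comp (continuous_id.add continuous_const)).add
      (hLc.comp (continuous_id.add continuous_const))).sub (continuous_const.mul hLc)
  -- the sequence `t_n = 1/(n+1)` and the Fatou functions `f_n = φ (SD/t² − μ + C t) ≥ 0`
  set tn : ℕ → ℝ := fun n => (1 : ℝ) / ((n : ℝ) + 1) with htn
  have htn0 : ∀ n, 0 < tn n := fun n => by positivity
  have htn_le : ∀ n, tn n ≤ 1 := fun n => by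
    show (1 : ℝ) / ((n : ℝ) + 1) ≤ 1
    rw [div_le_one (show (0 : ℝ) < (n : ℝ) + 1 by positivity)]; linarith [Nat.cast_nonneg (α := ℝ) n]
  have htlim : Tendsto tn atTop (𝓝[>] 0) :=
    tendsto_nhdsWithin_of_tendsto_nhds_of_eventually_within _ tendsto_one_div_add_atTop_nhds_zero_nat
      (Eventually.of_forall fun n => htn0 n)
  set f : ℕ → UnitAddTorus (Fin 3) → ℝ := fun n x => φ x * (SD (tn n) x / tn n ^ 2 - μ x + C * tn n) with hfdef
  have hf0 : ∀ n x, 0 ≤ f n x := by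
    intro n x
    have h := hC x (tn n)
    rw [abs_of_pos (htn0 n)] at h
    have ht2 : 0 < tn n ^ 2 := by positivity
    have h1 : μ x - C * tn n ≤ SD (tn n) x / tn n ^ 2 := by
      rw [le_div_iff₀ ht2]
      have e : (μ x - C * tn n) * tn n ^ 2 = tn n ^ 2 * μ x - C * tn n ^ 3 := by ring
      rw [e]; exact h
    exact mul_nonneg (hφnn x) (by linarith)
  have hfm : ∀ n, Measurable (f n) := fun n =>
    hφc.measurable.mul ((((hSDc _).measurable.div_const _).sub hμm).add_const _)
  have hfi : ∀ n, Integrable (f n) volume := by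
    intro n
    have h1 : Integrable (fun x => φ x * (SD (tn n) x / tn n ^ 2)) volume :=
      (hφc.mul ((hSDc _).div_const _)).integrable_unitAddTorus
    have h2 : Integrable (fun x => φ x * (C * tn n)) volume := (hφc.mul continuous_const).integrable_unitAddTorus
    refine ((h1.sub hint).add h2).congr (ae_of_all _ fun x => ?_)
    simp only [hfdef, Pi.add_apply, Pi.sub_apply]
    ring
  -- (A) the integrals of `f_n` converge to `T − q(q−1)∫λ^{q−2}|∇λ|²`
  set IA : ℝ := ∑ i, ∫ x, q * (q - 1) * L x ^ (q - 2) * Torus.partialDeriv i L x ^ 2 with hIAdef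
  set T : ℝ := heatDissipation (torusTopEigMoment q) v with hTdef
  have hT : T = -∫ x, φ x * μ x := by rw [hTdef, heatDissipation_topEigMoment_eq_integral hq1 hv hdv]
  have hSDint : ∀ t : ℝ, 0 < t → ∫ x, φ x * SD t x = -(t ^ 2) * ∑ i, ∫ x,
      (q * L (x + proj (t • EuclideanSpace.single i (1 : ℝ))) ^ (q - 1) - q * L x ^ (q - 1)) / t *
        ((L (x + proj (t • EuclideanSpace.single i (1 : ℝ))) - L x) / t) := by
    intro t ht
    have ht0 : t ≠ 0 := ht.ne'
    have hI3 : ∀ i, Integrable (fun x => φ x *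
        (L (x + proj (t • EuclideanSpace.single i (1 : ℝ))) +
          L (x + proj ((-t) • EuclideanSpace.single i (1 : ℝ))) - 2 * L x)) volume := fun i =>
      (hφc.mul (((hLc.comp (continuous_id.add continuous_const)).add
        (hLc.comp (continuous_id.add continuous_const))).sub (continuous_const.mul hLc))).integrable_unitAddTorus
    have e2 : (fun x => φ x * SD t x) = fun x => ∑ i, φ x *
        (L (x + proj (t • EuclideanSpace.single i (1 : ℝ))) +
          L (x + proj ((-t) • EuclideanSpace.single i (1 : ℝ))) - 2 * L x) := by
      funext x; simp only [hSDdef]; rw [Finset.mul_sum]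
    rw [e2, integral_finsetSum _ (fun i _ => hI3 i), Finset.mul_sum]
    refine Finset.sum_congr rfl fun i _ => ?_
    have hibp := integral_mul_secondDiff_eq hφc hLc (proj (t • EuclideanSpace.single i (1 : ℝ)))
    have e3 : (fun x => φ x * (L (x + proj (t • EuclideanSpace.single i (1 : ℝ))) +
          L (x + proj ((-t) • EuclideanSpace.single i (1 : ℝ))) - 2 * L x)) =
        fun x => φ x * (L (x + proj (t • EuclideanSpace.single i (1 : ℝ))) +
          L (x - proj (t • EuclideanSpace.single i (1 : ℝ))) - 2 * L x) := by
      funext x; rw [neg_smul, proj_neg, ← sub_eq_add_neg]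
    rw [e3, hibp, neg_mul, ← integral_const_mul]
    congr 1
    refine integral_congr_ae (ae_of_all _ fun x => ?_)
    show _ = t ^ 2 * _
    simp only [hφdef]
    field_simp
  have hlimI : Tendsto (fun n => ∫ x, f n x) atTop (𝓝 (-IA + T)) := by
    -- `∫ f_n = (∫ φ SD_n)/t_n² − ∫ φ μ + C t_n ∫ φ`
    have hrepr : ∀ n, ∫ x, f n x = -(∑ i, ∫ x,
        (q * L (x + proj (tn n • EuclideanSpace.single i (1 : ℝ))) ^ (q - 1) - q * L x ^ (q - 1)) / tn n *
          ((L (x + proj (tn n • EuclideanSpace.single i (1 : ℝ))) - L x) / tn n)) + T +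
        C * tn n * ∫ x, φ x := by
      intro n
      have ht := htn0 n
      have h1 : Integrable (fun x => φ x * (SD (tn n) x / tn n ^ 2)) volume :=
        (hφc.mul ((hSDc _).div_const _)).integrable_unitAddTorus
      have h2 : Integrable (fun x => φ x * (C * tn n)) volume := (hφc.mul continuous_const).integrable_unitAddTorus
      have e1 : ∫ x, f n x = (∫ x, φ x * (SD (tn n) x / tn n ^ 2)) - (∫ x, φ x * μ x) + ∫ x, φ x * (C * tn n) := by
        have ef : ∀ x, f n x = (φ x * (SD (tn n) x / tn n ^ 2) - φ x * μ x) + φ x * (C * tn n) := fun x => by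
          simp only [hfdef]; ring
        have hA : ∫ x, (φ x * (SD (tn n) x / tn n ^ 2) - φ x * μ x) =
            (∫ x, φ x * (SD (tn n) x / tn n ^ 2)) - ∫ x, φ x * μ x := integral_sub h1 hint
        have hB : ∫ x, ((φ x * (SD (tn n) x / tn n ^ 2) - φ x * μ x) + φ x * (C * tn n)) =
            (∫ x, (φ x * (SD (tn n) x / tn n ^ 2) - φ x * μ x)) + ∫ x, φ x * (C * tn n) :=
          integral_add (h1.sub hint) h2
        rw [integral_congr_ae (ae_of_all _ ef), hB, hA]
      have e2 : ∫ x, φ x * (SD (tn n) x / tn n ^ 2) = (∫ x, φ x * SD (tn n) x) / tn n ^ 2 := by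
        rw [← integral_div]
        refine integral_congr_ae (ae_of_all _ fun x => ?_)
        simp only; ring
      have e3 : ∫ x, φ x * (C * tn n) = C * tn n * ∫ x, φ x := by
        rw [← integral_const_mul]
        refine integral_congr_ae (ae_of_all _ fun x => ?_)
        simp only; ring
      rw [e1, e2, e3, hSDint _ ht, hT]
      have ht2 : tn n ^ 2 ≠ 0 := by positivity
      field_simp
      ring
    simp_rw [hrepr]
    have h1 : Tendsto (fun n => -(∑ i, ∫ x,
        (q * L (x + proj (tn n • EuclideanSpace.single i (1 : ℝ))) ^ (q - 1) - q * L x ^ (q - 1)) / tn n *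
          ((L (x + proj (tn n • EuclideanSpace.single i (1 : ℝ))) - L x) / tn n))) atTop (𝓝 (-IA)) :=
      ((tendsto_finsetSum Finset.univ fun i _ =>
        ((tendsto_integral_slope_mul_slope hq hv hdv i).2).comp htlim)).neg
    have h2 : Tendsto (fun n => C * tn n * ∫ x, φ x) atTop (𝓝 0) := by
      have h := ((tendsto_one_div_add_atTop_nhds_zero_nat).const_mul C).mul_const (∫ x, φ x)
      rw [mul_zero, zero_mul] at h
      exact h
    have h := (h1.add (tendsto_const_nhds (x := T))).add h2
    rw [add_zero] at h
    exact h
  -- (B) pointwise: on `U_s` the functions `f_n` converge to `2 φ R`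
  have hptU : ∀ x ∈ U, Tendsto (fun n => f n x) atTop (𝓝 (2 * (φ x * topChannelW v x))) := by
    intro x hx
    have hSDlim : Tendsto (fun n => SD (tn n) x / tn n ^ 2) atTop
        (𝓝 (∑ i, Torus.partialDeriv i (Torus.partialDeriv i L) x)) := by
      have hsum : Tendsto (fun t : ℝ => ∑ i, (L (x + proj (t • EuclideanSpace.single i (1 : ℝ))) +
          L (x + proj ((-t) • EuclideanSpace.single i (1 : ℝ))) - 2 * L x) / t ^ 2) (𝓝[>] 0)
          (𝓝 (∑ i, Torus.partialDeriv i (Torus.partialDeriv i L) x)) :=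
        tendsto_finsetSum _ fun i _ => tendsto_secondDiff_topEig_div_sq hv hx i
      have h := hsum.comp htlim
      refine h.congr fun n => ?_
      simp only [hSDdef, Function.comp, Finset.sum_div]
    have hCt : Tendsto (fun n => C * tn n) atTop (𝓝 0) := by
      have h := (tendsto_one_div_add_atTop_nhds_zero_nat).const_mul C
      rw [mul_zero] at h
      exact h
    have h := ((hSDlim.sub (tendsto_const_nhds (x := μ x))).add hCt).const_mul (φ x)
    rw [sum_partialDeriv_partialDeriv_topEig_eq_of_simple hv hx] at h
    refine h.congr' (Eventually.of_forall fun n => by simp only [hfdef]) |>.trans ?_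
    have e : φ x * (μ x + 2 * topChannelW v x - μ x + 0) = 2 * (φ x * topChannelW v x) := by ring
    rw [e]
  -- (C) Fatou along the sequence
  set G : UnitAddTorus (Fin 3) → ℝ := Set.indicator U (fun x => φ x * topChannelW v x) with hGdef
  have hG_le : ∀ x, ENNReal.ofReal (2 * G x) ≤ liminf (fun n => ENNReal.ofReal (f n x)) atTop := by
    intro x
    by_cases hx : x ∈ U
    · have h := (ENNReal.tendsto_ofReal (hptU x hx))
      rw [hGdef, Set.indicator_of_mem hx, h.liminf_eq]
    · rw [hGdef, Set.indicator_of_notMem hx, mul_zero, ENNReal.ofReal_zero]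
      exact bot_le
  have hFatou := lintegral_liminf_le' (μ := volume) (u := atTop) (fun n => (hfm n).aemeasurable.ennreal_ofReal)
  have hlimsup : liminf (fun n => ∫⁻ x, ENNReal.ofReal (f n x)) atTop = ENNReal.ofReal (-IA + T) := by
    have he : ∀ n, ∫⁻ x, ENNReal.ofReal (f n x) = ENNReal.ofReal (∫ x, f n x) := fun n =>
      (ofReal_integral_eq_lintegral_ofReal (hfi n) (ae_of_all _ (hf0 n))).symm
    simp_rw [he]
    exact ((ENNReal.tendsto_ofReal hlimI)).liminf_eq
  have hGint_le : ∫⁻ x, ENNReal.ofReal (2 * G x) ≤ ENNReal.ofReal (-IA + T) :=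
    (lintegral_mono hG_le).trans (hFatou.trans_eq hlimsup)
  -- (D) measurability / integrability of `G`, and the Bochner form
  have hG0 : ∀ x, 0 ≤ G x := by
    intro x
    by_cases hx : x ∈ U
    · rw [hGdef, Set.indicator_of_mem hx]
      exact mul_nonneg (hφnn x) (topChannelW_nonneg hx)
    · rw [hGdef, Set.indicator_of_notMem hx]
  have hGm : AEStronglyMeasurable G volume := by
    -- `G = 1_U · (lim f_n)/2` on `U`: write it as the indicator of the pointwise `liminf`
    have hlm : Measurable fun x => liminf (fun n => f n x) atTop := Measurable.liminf fun n => hfm n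
    have hEq : G = Set.indicator U (fun x => liminf (fun n => f n x) atTop / 2) := by
      funext x
      by_cases hx : x ∈ U
      · rw [hGdef, Set.indicator_of_mem hx, Set.indicator_of_mem hx, (hptU x hx).liminf_eq]
        ring
      · rw [hGdef, Set.indicator_of_notMem hx, Set.indicator_of_notMem hx]
    rw [hEq]
    exact ((hlm.div_const 2).indicator hUo.measurableSet).aestronglyMeasurable
  have hGint : Integrable G volume := by
    refine ⟨hGm, ?_⟩
    have h2 : ∫⁻ x, ENNReal.ofReal (2 * G x) = 2 * ∫⁻ x, ENNReal.ofReal (G x) := by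
      rw [← lintegral_const_mul' _ _ (by norm_num : (2 : ℝ≥0∞) ≠ ⊤)]
      refine lintegral_congr fun x => ?_
      rw [ENNReal.ofReal_mul (by norm_num : (0:ℝ) ≤ 2)]
      norm_num
    have hfin : ∫⁻ x, ENNReal.ofReal (G x) < ⊤ := by
      have h3 : 2 * ∫⁻ x, ENNReal.ofReal (G x) < ⊤ := by
        rw [← h2]; exact lt_of_le_of_lt hGint_le ENNReal.ofReal_lt_top
      exact lt_of_le_of_lt (le_mul_of_one_le_left (by simp) (by norm_num)) h3
    exact (hasFiniteIntegral_iff_ofReal (ae_of_all _ hG0)).2 hfin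
  -- the Bochner inequality
  have hBoch : 2 * ∫ x, G x ≤ -IA + T := by
    have h1 : ∫⁻ x, ENNReal.ofReal (2 * G x) = ENNReal.ofReal (∫ x, 2 * G x) :=
      (ofReal_integral_eq_lintegral_ofReal (hGint.const_mul 2)
        (ae_of_all _ fun x => mul_nonneg zero_le_two (hG0 x))).symm
    have h2 : ENNReal.ofReal (∫ x, 2 * G x) ≤ ENNReal.ofReal (-IA + T) := h1 ▸ hGint_le
    have hpos : 0 ≤ -IA + T := by
      -- from `0 ≤ ∫ f_n → −IA + T`
      exact ge_of_tendsto' hlimI fun n => integral_nonneg (hf0 n)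
    rw [integral_const_mul] at h2
    exact (ENNReal.ofReal_le_ofReal_iff hpos).1 h2
  -- bookkeeping: `IA = q(q−1)∫λ^{q−2}Σ(∂ᵢλ)²`, and the indicator form of `G`
  have hIA : IA = q * (q - 1) * ∫ x, L x ^ (q - 2) * ∑ i, Torus.partialDeriv i (fun y => L y) x ^ 2 := by
    rw [hIAdef, ← integral_finsetSum Finset.univ (fun i _ => (tendsto_integral_slope_mul_slope hq hv hdv i).1),
      ← integral_const_mul]
    refine integral_congr_ae (ae_of_all _ fun x => ?_)
    show _ = q * (q - 1) * (L x ^ (q - 2) * ∑ i, Torus.partialDeriv i L x ^ 2)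
    rw [Finset.mul_sum, Finset.mul_sum]
    exact Finset.sum_congr rfl fun i _ => by ring
  refine ⟨hGint, ?_⟩
  rw [← hIA]
  linarith [hBoch]

end TopEig

end Summit.NavierStokesRegularity.FunctionalMining

end
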